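import Summits.CriticalPhenomena.Ising3DConformalLimit.Theses.InverseSquareTelemetry
import Summits.CriticalPhenomena.Ising3DConformalLimit.Theses.PerfectScreening
import Summits.CriticalPhenomena.Ising3DConformalLimit.Theses.PrecisionLaplacian
import Summits.CriticalPhenomena.Ising3DConformalLimit.Theses.AnomalousForcesInteraction
import Summits.CriticalPhenomena.Ising3DConformalLimit.Theorems.CoulombImpliesNontrivial.Negative.Antecedent
import Summits.CriticalPhenomena.Ising3DConformalLimit.Theorems.CoulombImpliesNontrivial.Negative.LatticeShadow
import Summits.CriticalPhenomena.Ising3DConformalLimit.Theorems.PerfectScreeningNonSaturation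
import Summits.CriticalPhenomena.Ising3DConformalLimit.Theorems.InverseSquareTelemetryPowerLawFromTelemetry
import Summits.CriticalPhenomena.Ising3DConformalLimit.Theorems.PerfectScreeningScreeningDichotomyGreen
import Literature.Probability.LatticeModels.CriticalTwoPointLawDimension
import HarnessLib

/-!
# Crux `InverseSquareTelemetry.TwoPointSpineComplement` (stmt-CriticalPhenomena-4497), line `registered`:
# the Coulomb corner `Δ = 1/2` (stub `stub_coulombCorner`, α′) — EDGES to the ledger, and its model-blind shadow

THEOREM-ONLY helper file (`--supports stmt-CriticalPhenomena-4497`; no definition, no named fact, no `sorry`).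

The registered stub α′ of the skeleton reads: for every `c > 0`, if the critical two-point function of the
nearest-neighbour Ising model on `ℤ³` obeys the COULOMB LAW `⟨σ₀σ_x⟩⁺_{β_c(3)}·|x|₂^{2·(1/2)} → c` along the
cofinite filter (`|x|₂ = √(∑ xᵢ²)`), then every non-degenerate pointwise scaling limit `(ρ, S)` of
`criticalCorr 3` that is Möbius covariant with dimension `1/2` has `U₄ ≢ 0` (`HasNontrivialU4 S`).

What this file proves, kernel-checked:

* `not_nonSaturation_of_coulombLaw`, `coulombLower_of_coulombLaw` — the Coulomb law (exact two-sided isotropic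
  asymptotics) gives the Coulomb LOWER BOUND `∃ c' > 0, ∀ x ≠ 0, c'/‖x‖_∞ ≤ ⟨σ₀σ_x⟩` (the antecedent of crux
  stmt-CriticalPhenomena-13885 `PerfectScreening.CoulombImpliesNontrivial`), equivalently it REFUTES the support
  item stmt-CriticalPhenomena-1342 `PerfectScreening.NonSaturation` (eventually `|x|₂ G > c/2`, `|x|₂ ≤ 2‖x‖_∞`,
  and the tree's `nonSaturation_iff_frequently_cofinite` / `coulombLower_of_not_nonSaturation`);
* the four payer EDGES of the stub, each one line on top of that:
  `stub_coulombCorner_of_coulombImpliesNontrivial` (13885 ⟹ α′),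
  `stub_coulombCorner_of_nonGaussian` (0636 `IsingEuclidUpgradeR4NonGaussian` ⟹ α′),
  `stub_coulombCorner_of_nonSaturation` (1342 ⟹ α′, VACUOUSLY: 1342 refutes the hypothesis),
  `stub_coulombCorner_of_etaPositive` (2600 `EtaPositive` ⟹ α′, vacuously, through `nonSaturation_of_etaPositive`);
  since `CoulombImpliesNontrivial ↔ NonSaturation ∨ IsingEuclidUpgradeR4NonGaussian`
  (`coulombImpliesNontrivial_iff_nonSaturation_or`, landed), 13885 is the weakest of the four payers;
* `stub_coulombCorner_iff_anyDimension` — the Möbius hypothesis of α′ may be taken at ANY dimension `Δ`: under the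
  Coulomb law every non-degenerate Möbius-covariant limit has `Δ = 1/2` (`moebiusDimension_eq_half_of_coulomb`);
* `not_stubShadow` — the two EXTRA hypotheses of α′ over crux 13885 (exactness/isotropy of the law, Möbius(1/2)
  covariance of `S`) do NOT make it provable from two-point data: replacing `criticalCorr 3` by an arbitrary lattice
  family, the statement FAILS for the massless free family sampled on `ℤ³` (`sampleOnLattice (gffFamily (1/2))`:
  exact law `G·|x|₂ = 1`, pointwise limit `gffFamily (1/2)` under `ρ = δ^{-1/2}`, non-degenerate, Möbius covariant
  with `Δ = 1/2`, `U₄ ≡ 0`). A proof of α′ must use the Ising lattice structure (random currents), i.e. the open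
  content of 13885 / 0636; α′ stays OPEN, blocked on stmt-CriticalPhenomena-13885.

References: Aizenman, Comm. Math. Phys. 86 (1982) §1; Aizenman–Duminil-Copin, Ann. of Math. 194 (2021) eq. (3.11);
Duminil-Copin, ICM 2022, §4.2.1 and §8.4; Di Francesco–Mathieu–Sénéchal (1997) §4.3.1 (free field).
-/

noncomputable section

namespace Summit.CriticalPhenomena.Ising3DConformalLimit.InverseSquareTelemetryTwoPointSpineComplement.CoulombCorner

open Literature.Probability.LatticeModels Filter Topology EuclideanGeometry
open Summit.CriticalPhenomena.Ising3DConformalLimit.Theses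
open Summit.CriticalPhenomena.Ising3DConformalLimit.Theorems
  (nonSaturation_iff_frequently_cofinite coulombLower_of_not_nonSaturation nonSaturation_of_etaPositive
    criticalTwoPoint_three_pos_of_ne_zero)
open Summit.CriticalPhenomena.Ising3DConformalLimit.CoulombImpliesNontrivialNegative
  (moebiusDimension_eq_half_of_coulomb sampleOnLattice hasPointwiseScalingLimit_gff_sample
    sampleOnLattice_gff_half_two)

/-! ### The Coulomb law gives the Coulomb lower bound -/

/-- **The Coulomb law refutes `NonSaturation` (stmt-1342).** If `⟨σ₀σ_x⟩·|x|₂^{2·(1/2)} → c > 0` cofinitely,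
then eventually `‖x‖_∞·⟨σ₀σ_x⟩ ≥ c/4` (`|x|₂ ≤ 2‖x‖_∞`), which is incompatible with
`liminf ‖x‖_∞·⟨σ₀σ_x⟩ = 0` (`nonSaturation_iff_frequently_cofinite`). [folklore] -/
theorem not_nonSaturation_of_coulombLaw {c : ℝ} (hc : 0 < c)
    (h : Tendsto (fun x : Site 3 =>
        criticalTwoPoint 3 x * Real.sqrt (∑ i, ((x i : ℝ)) ^ 2) ^ (2 * (1 / 2 : ℝ))) cofinite (nhds c)) :
    ¬ PerfectScreening.NonSaturation := by
  rw [nonSaturation_iff_frequently_cofinite]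
  intro hNS
  have hev : ∀ᶠ x : Site 3 in cofinite, c / 4 ≤ ‖x‖ * criticalTwoPoint 3 x := by
    filter_upwards [h.eventually (lt_mem_nhds (half_lt_self hc)), eventually_cofinite_ne 0] with x hx hx0
    rw [show (2 * (1 / 2 : ℝ)) = 1 by norm_num, Real.rpow_one] at hx
    have hG : 0 ≤ criticalTwoPoint 3 x := (criticalTwoPoint_three_pos_of_ne_zero hx0).le
    have h2 : Real.sqrt (∑ i, ((x i : ℝ)) ^ 2) ≤ 2 * ‖x‖ := Theorems.PerfectScreening.sqrt_sum_sq_le_two_mul_norm x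
    nlinarith [mul_le_mul_of_nonneg_left h2 hG]
  obtain ⟨x, hlt, hle⟩ := ((hNS (c / 4) (by positivity)).and_eventually hev).exists
  linarith

/-- **The Coulomb law gives the Coulomb lower bound** `∃ c' > 0, ∀ x ≠ 0, c'/‖x‖_∞ ≤ ⟨σ₀σ_x⟩⁺_{β_c(3)}` — the
antecedent of crux `PerfectScreening.CoulombImpliesNontrivial` (stmt-13885) — via
`coulombLower_of_not_nonSaturation` (Messager–Miracle-Solé on the finitely many small sites). [folklore] -/
theorem coulombLower_of_coulombLaw {c : ℝ} (hc : 0 < c)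
    (h : Tendsto (fun x : Site 3 =>
        criticalTwoPoint 3 x * Real.sqrt (∑ i, ((x i : ℝ)) ^ 2) ^ (2 * (1 / 2 : ℝ))) cofinite (nhds c)) :
    ∃ c' : ℝ, 0 < c' ∧ ∀ x : Site 3, x ≠ 0 → c' / ‖x‖ ≤ criticalTwoPoint 3 x :=
  coulombLower_of_not_nonSaturation (not_nonSaturation_of_coulombLaw hc h)

/-! ### The payer edges of stub α′ -/

/-- **Edge 13885 ⟹ α′ (registered bookkeeping stub `stub_coulombCorner_of_coulombImpliesNontrivial` of item
stmt-CriticalPhenomena-4497; conclusion = the registered stub `stub_coulombCorner` VERBATIM).** Crux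
`PerfectScreening.CoulombImpliesNontrivial` (stmt-CriticalPhenomena-13885) pays the Coulomb corner: the law supplies
its Coulomb lower bound (`coulombLower_of_coulombLaw`); the Möbius hypothesis is not even used. CONDITIONAL theorem:
it credits nothing by itself. [folklore] -/
theorem stub_coulombCorner_of_coulombImpliesNontrivial : Summit.CriticalPhenomena.Ising3DConformalLimit.Theses.PerfectScreening.CoulombImpliesNontrivial → ∀ c : ℝ, 0 < c → Tendsto (fun x : Site 3 => criticalTwoPoint 3 x * Real.sqrt (∑ i, ((x i : ℝ)) ^ 2) ^ (2 * (1 / 2 : ℝ))) cofinite (nhds c) → ∀ (ρ : ℝ → ℝ) (S : CorrFamily 3), (∀ δ ∈ Set.Ioc (0:ℝ) 1, 0 < ρ δ) → HasPointwiseScalingLimit (criticalCorr 3) ρ S → IsNondegenerateTwoPoint S → IsMoebiusCovariant (1 / 2) S → HasNontrivialU4 S :=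
  fun h13885 _c hc hlaw ρ S hρ hlim hnd _ => h13885 (coulombLower_of_coulombLaw hc hlaw) ρ S hρ hlim hnd

/-- **Edge 0636 ⟹ α′.** Crux `IsingEuclidUpgradeR4NonGaussian` (item stmt-CriticalPhenomena-0636, here in its
`PrecisionLaplacian` copy; definitionally the `IsingEuclidUpgrade` one) pays the corner outright. [folklore] -/
theorem stub_coulombCorner_of_nonGaussian (h0636 : PrecisionLaplacian.IsingEuclidUpgradeR4NonGaussian) :
    ∀ c : ℝ, 0 < c →
      Tendsto (fun x : Site 3 =>
        criticalTwoPoint 3 x * Real.sqrt (∑ i, ((x i : ℝ)) ^ 2) ^ (2 * (1 / 2 : ℝ))) cofinite (nhds c) →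
      ∀ (ρ : ℝ → ℝ) (S : CorrFamily 3), (∀ δ ∈ Set.Ioc (0:ℝ) 1, 0 < ρ δ) →
        HasPointwiseScalingLimit (criticalCorr 3) ρ S → IsNondegenerateTwoPoint S →
        IsMoebiusCovariant (1 / 2) S → HasNontrivialU4 S :=
  fun _c _hc _hlaw ρ S hρ hlim hnd _ => h0636 ρ S hρ hlim hnd

/-- **Edge 1342 ⟹ α′ (vacuity).** The support item `PerfectScreening.NonSaturation` (stmt-CriticalPhenomena-1342,
the weakest form of `η(3) > 0`) refutes the Coulomb law, so it pays the corner vacuously. [folklore] -/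
theorem stub_coulombCorner_of_nonSaturation (h1342 : PerfectScreening.NonSaturation) :
    ∀ c : ℝ, 0 < c →
      Tendsto (fun x : Site 3 =>
        criticalTwoPoint 3 x * Real.sqrt (∑ i, ((x i : ℝ)) ^ 2) ^ (2 * (1 / 2 : ℝ))) cofinite (nhds c) →
      ∀ (ρ : ℝ → ℝ) (S : CorrFamily 3), (∀ δ ∈ Set.Ioc (0:ℝ) 1, 0 < ρ δ) →
        HasPointwiseScalingLimit (criticalCorr 3) ρ S → IsNondegenerateTwoPoint S →
        IsMoebiusCovariant (1 / 2) S → HasNontrivialU4 S :=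
  fun _c hc hlaw _ _ _ _ _ _ => absurd h1342 (not_nonSaturation_of_coulombLaw hc hlaw)

/-- **Edge 2600 ⟹ α′ (vacuity).** Crux `AnomalousForcesInteraction.EtaPositive` (stmt-CriticalPhenomena-2600,
`⟨σ₀σ_x⟩ ≤ C‖x‖^{-(1+κ)}`, `κ > 0`) implies `NonSaturation` (`nonSaturation_of_etaPositive`), hence refutes the
Coulomb law and pays the corner vacuously — the physically expected branch (`η(3) ≈ 0.036`). [folklore] -/
theorem stub_coulombCorner_of_etaPositive (h2600 : AnomalousForcesInteraction.EtaPositive) :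
    ∀ c : ℝ, 0 < c →
      Tendsto (fun x : Site 3 =>
        criticalTwoPoint 3 x * Real.sqrt (∑ i, ((x i : ℝ)) ^ 2) ^ (2 * (1 / 2 : ℝ))) cofinite (nhds c) →
      ∀ (ρ : ℝ → ℝ) (S : CorrFamily 3), (∀ δ ∈ Set.Ioc (0:ℝ) 1, 0 < ρ δ) →
        HasPointwiseScalingLimit (criticalCorr 3) ρ S → IsNondegenerateTwoPoint S →
        IsMoebiusCovariant (1 / 2) S → HasNontrivialU4 S :=
  stub_coulombCorner_of_nonSaturation (nonSaturation_of_etaPositive h2600)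

/-! ### The Möbius dimension is immaterial under the Coulomb law -/

/-- **α′ with the Möbius hypothesis at ANY dimension.** Under the Coulomb law every non-degenerate Möbius-covariant
pointwise limit of `criticalCorr 3` has `Δ = 1/2` (`moebiusDimension_eq_half_of_coulomb`), so the stub is
equivalent to its version quantified over all `Δ`. [folklore] -/
theorem stub_coulombCorner_iff_anyDimension :
    (∀ c : ℝ, 0 < c →
      Tendsto (fun x : Site 3 =>
        criticalTwoPoint 3 x * Real.sqrt (∑ i, ((x i : ℝ)) ^ 2) ^ (2 * (1 / 2 : ℝ))) cofinite (nhds c) →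
      ∀ (ρ : ℝ → ℝ) (S : CorrFamily 3), (∀ δ ∈ Set.Ioc (0:ℝ) 1, 0 < ρ δ) →
        HasPointwiseScalingLimit (criticalCorr 3) ρ S → IsNondegenerateTwoPoint S →
        IsMoebiusCovariant (1 / 2) S → HasNontrivialU4 S) ↔
    (∀ c : ℝ, 0 < c →
      Tendsto (fun x : Site 3 =>
        criticalTwoPoint 3 x * Real.sqrt (∑ i, ((x i : ℝ)) ^ 2) ^ (2 * (1 / 2 : ℝ))) cofinite (nhds c) →
      ∀ (ρ : ℝ → ℝ) (Δ : ℝ) (S : CorrFamily 3), (∀ δ ∈ Set.Ioc (0:ℝ) 1, 0 < ρ δ) →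
        HasPointwiseScalingLimit (criticalCorr 3) ρ S → IsNondegenerateTwoPoint S →
        IsMoebiusCovariant Δ S → HasNontrivialU4 S) := by
  constructor
  · intro h c hc hlaw ρ Δ S hρ hlim hnd hM
    have hΔ : Δ = 1 / 2 := moebiusDimension_eq_half_of_coulomb (coulombLower_of_coulombLaw hc hlaw) hρ hlim hnd hM
    subst hΔ
    exact h c hc hlaw ρ S hρ hlim hnd hM
  · intro h c hc hlaw ρ S hρ hlim hnd hM
    exact h c hc hlaw ρ (1 / 2) S hρ hlim hnd hM

/-! ### The model-blind shadow of α′ is false -/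

/-- The massless free family sampled on `ℤ³` obeys the EXACT Coulomb law `G₂(0,x)·|x|₂^{2·(1/2)} = 1` off the
origin (`G₂(0,x) = 1/‖siteVec x‖₂ = 1/|x|₂`). [folklore] -/
theorem sampleOnLattice_gff_half_law {x : Site 3} (hx : x ≠ 0) :
    sampleOnLattice (gffFamily (1 / 2)) 2 ![0, x] * Real.sqrt (∑ i, ((x i : ℝ)) ^ 2) ^ (2 * (1 / 2 : ℝ)) = 1 := by
  rw [sampleOnLattice_gff_half_two, show (2 * (1 / 2 : ℝ)) = 1 by norm_num, Real.rpow_one,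
    Theorems.PerfectScreening.sqrt_sum_sq_eq_norm_toLp]
  change 1 / ‖siteVec x‖ * ‖siteVec x‖ = 1
  have hpos : 0 < ‖siteVec x‖ := by
    have h1 : (0:ℝ) < ‖x‖ := norm_pos_iff.2 hx
    exact h1.trans_le (CoulombImpliesNontrivialNegative.norm_le_norm_siteVec x)
  field_simp

/-- **The MODEL-BLIND SHADOW of stub α′ is FALSE.** Replace `criticalCorr 3` by an arbitrary lattice family `G`:
then "exact isotropic Coulomb law for `G₂(0,·)` ⟹ every non-degenerate Möbius(1/2)-covariant pointwise scaling
limit of `G` has `U₄ ≢ 0`" fails for `G = sampleOnLattice (gffFamily (1/2))`, whose pointwise scaling limit under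
`ρ(δ) = δ^{-1/2}` is the massless free family itself (non-degenerate, Möbius covariant with `Δ = 1/2`, `U₄ ≡ 0`).
So neither extra hypothesis of α′ over crux 13885 (exactness of the law; Möbius(1/2) covariance of the limit)
substitutes for the Ising-specific input. [cite: FrancescoMathieuSenechal1997, §4.3.1] -/
theorem not_stubShadow :
    ¬ ∀ G : LatticeCorrFamily 3,
      (∃ c : ℝ, 0 < c ∧
        Tendsto (fun x : Site 3 => G 2 ![0, x] * Real.sqrt (∑ i, ((x i : ℝ)) ^ 2) ^ (2 * (1 / 2 : ℝ)))
          cofinite (nhds c)) →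
      ∀ (ρ : ℝ → ℝ) (S : CorrFamily 3), (∀ δ ∈ Set.Ioc (0:ℝ) 1, 0 < ρ δ) →
        HasPointwiseScalingLimit G ρ S → IsNondegenerateTwoPoint S →
        IsMoebiusCovariant (1 / 2) S → HasNontrivialU4 S := by
  intro h
  refine not_hasNontrivialU4_gff (1 / 2) (h (sampleOnLattice (gffFamily (1 / 2))) ?_
    (fun δ => δ ^ (-(1 / 2 : ℝ))) (gffFamily (1 / 2)) (fun δ hδ => Real.rpow_pos_of_pos hδ.1 _)
    (hasPointwiseScalingLimit_gff_sample (1 / 2)) (isNondegenerateTwoPoint_gff _) (isMoebiusCovariant_gff _))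
  refine ⟨1, one_pos, ?_⟩
  refine (tendsto_const_nhds (x := (1:ℝ))).congr' ?_
  filter_upwards [eventually_cofinite_ne 0] with x hx
  exact (sampleOnLattice_gff_half_law hx).symm

end Summit.CriticalPhenomena.Ising3DConformalLimit.InverseSquareTelemetryTwoPointSpineComplement.CoulombCorner

end
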